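import Mathlib
import Summits.NavierStokesRegularity.NavierStokesRegularity.Theorems.TaoLadderRungTwoBreakNoSurvivingEternalViscBddOneSubDyadicSpread
import HarnessLib

/-!
# PAIR RIGIDITY below the dyadic spread: on a table of `E₂(R)`, `R < 2`, every cancellation orbit of structure constants
  is a SIGNED PAIR — of the three symmetric pair-values `u + v + w = 0` of (4.3) at most two are non-zero, and then they
  are opposite; in particular every sub-dyadic outflow monomial `x_j x_k ↦ y_i` reacts back on EXACTLY ONE of its two
  inputs (structural remark for the «∀ R ≥ 1» cruxes of route TaoLadderRungTwoBreak, here K2(1) `BlowupRigidityOne`,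
  stmt-NavierStokesRegularity-20206, whose outflow-live cores (`…OutflowCore`) it constrains; `--supports`)

MODEL lattice (Tao 2016 §4 (4.1)–(4.3), §6.1) only; nothing here is a statement about the Navier–Stokes equations; no
stub, crux, rung or summit is proved.  DEF-FREE; ROUTE-INDEPENDENT.  Pure algebra of the structure constants,
generalising the square-orbit facts `outflowSq_eq` / `rotorSq_eq` / `sqCoeff_eq_zero_of_lt_two` of `…SubDyadicSpread`
(there two of the three pair-values coincide, forcing the ratio `−2`; here the orbit is arbitrary).

* `shiftSet_perm` — Tao's shift set is closed under the coordinate permutations used below;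
* `cancel_three` — THREE-TERM CANCELLATION: for a symmetric cancelling table, every index triple and shift `μ ∈ S`,
  `α_{i₁i₂i₃,(μ₁μ₂μ₃)} + α_{i₁i₃i₂,(μ₁μ₃μ₂)} + α_{i₂i₃i₁,(μ₂μ₃μ₁)} = 0` (the six terms of (4.3) pair up under (4.2));
* `pair_rigidity_of_lt_two` — on `E₂(R)`, `0 < R < 2`: one of the three pair-values vanishes, and if the first is
  non-zero then exactly one of the other two is non-zero and equals its negative (three reals of modulus in
  `{0} ∪ (1/2, 1]` cannot sum to zero unless one vanishes);
* `outflow_single_partner_of_lt_two` — for an outflow constant `u = α_{jk i,(0,0,1)} ≠ 0` below the dyadic spread: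
  `j ≠ k`, and of the two back-reaction partners `α_{ji k,(0,1,0)}` («`y_i` acts on `x_j`'s partner `k`») and
  `α_{ki j,(0,1,0)}` exactly one is non-zero, with value `−u`.

HONEST LABEL: bookkeeping for the planner's sub-dyadic corner `1 ≤ R < 2`; rung 0.
-/

noncomputable section

-- the summit and its single sub-problem share the name (CONVENTIONS §1)
set_option linter.dupNamespace false

namespace Summit.NavierStokesRegularity.NavierStokesRegularity.Theorems

namespace BlowupRigidityOne

open Literature.Analysis.FluidPDE Literature.Analysis.FluidPDE.TaoCascade

variable {m : ℕ} {R : ℝ} {α : Fin m → Fin m → Fin m → ℤ × ℤ × ℤ → ℝ}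

/-- Tao's shift set `S = {(000),(100),(010),(001)}` is invariant under the coordinate permutations
`(μ₁,μ₂,μ₃) ↦ (μ₂,μ₁,μ₃), (μ₁,μ₃,μ₂), (μ₂,μ₃,μ₁), (μ₃,μ₁,μ₂), (μ₃,μ₂,μ₁)`.
[cite: Tao2016AveragedNS, §4 after (4.1) («S is invariant under permutations of the three coordinates»)] -/
theorem shiftSet_perm {μ₁ μ₂ μ₃ : ℤ} (h : (μ₁, μ₂, μ₃) ∈ shiftSet) :
    (μ₂, μ₁, μ₃) ∈ shiftSet ∧ (μ₁, μ₃, μ₂) ∈ shiftSet ∧ (μ₂, μ₃, μ₁) ∈ shiftSet ∧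
      (μ₃, μ₁, μ₂) ∈ shiftSet ∧ (μ₃, μ₂, μ₁) ∈ shiftSet := by
  rw [mem_shiftSet_iff] at h
  simp only [Prod.mk.injEq] at h
  rcases h with ⟨rfl, rfl, rfl⟩ | ⟨rfl, rfl, rfl⟩ | ⟨rfl, rfl, rfl⟩ | ⟨rfl, rfl, rfl⟩ <;>
    simp [mem_shiftSet_iff]

/-- **THREE-TERM CANCELLATION.**  For a symmetric (4.2) cancelling (4.3) table, the six terms of the cancellation sum
pair up under the transposition of the first two slots, leaving
`α_{i₁i₂i₃,(μ₁μ₂μ₃)} + α_{i₁i₃i₂,(μ₁μ₃μ₂)} + α_{i₂i₃i₁,(μ₂μ₃μ₁)} = 0` for every index triple and every `μ ∈ S`.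
[cite: Tao2016AveragedNS, §4 (4.2)–(4.3)] -/
theorem cancel_three (hs : IsSymmetricCoeff α) (hc : IsCancellingCoeff α) (i₁ i₂ i₃ : Fin m) {μ₁ μ₂ μ₃ : ℤ}
    (hμ : (μ₁, μ₂, μ₃) ∈ shiftSet) :
    α i₁ i₂ i₃ (μ₁, μ₂, μ₃) + α i₁ i₃ i₂ (μ₁, μ₃, μ₂) + α i₂ i₃ i₁ (μ₂, μ₃, μ₁) = 0 := by
  obtain ⟨h213, _, _, h312, h321⟩ := shiftSet_perm hμ
  have h6 := hc i₁ i₂ i₃ μ₁ μ₂ μ₃ hμ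
  have e3 : α i₂ i₁ i₃ (μ₂, μ₁, μ₃) = α i₁ i₂ i₃ (μ₁, μ₂, μ₃) := hs i₂ i₁ i₃ μ₂ μ₁ μ₃ h213
  have e5 : α i₃ i₁ i₂ (μ₃, μ₁, μ₂) = α i₁ i₃ i₂ (μ₁, μ₃, μ₂) := hs i₃ i₁ i₂ μ₃ μ₁ μ₂ h312
  have e6 : α i₃ i₂ i₁ (μ₃, μ₂, μ₁) = α i₂ i₃ i₁ (μ₂, μ₃, μ₁) := hs i₃ i₂ i₁ μ₃ μ₂ μ₁ h321
  rw [e3, e5, e6] at h6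
  linarith

/-- Three reals of modulus in `{0} ∪ (1/2, 1]` summing to zero: one of them vanishes, and a non-zero one has exactly one
non-zero companion, equal to its negative. [folklore] -/
theorem signed_pair_of_sum_eq_zero {u v w : ℝ} (hsum : u + v + w = 0)
    (hu : |u| ≤ 1 ∧ (u = 0 ∨ 1 / 2 < |u|)) (hv : |v| ≤ 1 ∧ (v = 0 ∨ 1 / 2 < |v|))
    (hw : |w| ≤ 1 ∧ (w = 0 ∨ 1 / 2 < |w|)) :
    (u = 0 ∨ v = 0 ∨ w = 0) ∧ (u ≠ 0 → (v = -u ∧ w = 0) ∨ (w = -u ∧ v = 0)) := by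
  have hzero : u = 0 ∨ v = 0 ∨ w = 0 := by
    by_contra hne
    push Not at hne
    obtain ⟨hu0, hv0, hw0⟩ := hne
    have hu' : 1 / 2 < |u| := hu.2.resolve_left hu0
    have hv' : 1 / 2 < |v| := hv.2.resolve_left hv0
    have hw' : 1 / 2 < |w| := hw.2.resolve_left hw0
    have hu1 := hu.1; have hv1 := hv.1; have hw1 := hw.1
    rcases le_or_gt 0 u with h1 | h1 <;> rcases le_or_gt 0 v with h2 | h2 <;> rcases le_or_gt 0 w with h3 | h3
    all_goals
      first
        | (rw [abs_of_nonneg h1] at hu' hu1)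
        | (rw [abs_of_neg h1] at hu' hu1)
    all_goals
      first
        | (rw [abs_of_nonneg h2] at hv' hv1)
        | (rw [abs_of_neg h2] at hv' hv1)
    all_goals
      first
        | (rw [abs_of_nonneg h3] at hw' hw1)
        | (rw [abs_of_neg h3] at hw' hw1)
    all_goals linarith
  refine ⟨hzero, fun hu0 => ?_⟩
  rcases hzero with h | h | h
  · exact absurd h hu0
  · exact Or.inr ⟨by linarith, h⟩
  · exact Or.inl ⟨by linarith, h⟩

/-- **PAIR RIGIDITY BELOW THE DYADIC SPREAD.**  On `α ∈ E₂(R)`, `0 < R < 2`, for every index triple and every `μ ∈ S`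
the three pair-values `u = α_{i₁i₂i₃,(μ₁μ₂μ₃)}`, `v = α_{i₁i₃i₂,(μ₁μ₃μ₂)}`, `w = α_{i₂i₃i₁,(μ₂μ₃μ₁)}` (which sum to zero,
`cancel_three`) satisfy: one of them vanishes, and if `u ≠ 0` then exactly one of `v, w` is non-zero and equals `−u`
(non-zero constants have modulus in `[R⁻¹, 1] ⊂ (1/2, 1]`).
[cite: Tao2016AveragedNS, §4 (4.2)–(4.3), §6.1; cell vocabulary (`InTableClass`)] -/
theorem pair_rigidity_of_lt_two (hα : InTableClass R α) (hR0 : 0 < R) (hR : R < 2) (i₁ i₂ i₃ : Fin m)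
    {μ₁ μ₂ μ₃ : ℤ} (hμ : (μ₁, μ₂, μ₃) ∈ shiftSet) :
    (α i₁ i₂ i₃ (μ₁, μ₂, μ₃) = 0 ∨ α i₁ i₃ i₂ (μ₁, μ₃, μ₂) = 0 ∨ α i₂ i₃ i₁ (μ₂, μ₃, μ₁) = 0) ∧
    (α i₁ i₂ i₃ (μ₁, μ₂, μ₃) ≠ 0 →
      (α i₁ i₃ i₂ (μ₁, μ₃, μ₂) = -α i₁ i₂ i₃ (μ₁, μ₂, μ₃) ∧ α i₂ i₃ i₁ (μ₂, μ₃, μ₁) = 0) ∨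
      (α i₂ i₃ i₁ (μ₂, μ₃, μ₁) = -α i₁ i₂ i₃ (μ₁, μ₂, μ₃) ∧ α i₁ i₃ i₂ (μ₁, μ₃, μ₂) = 0)) := by
  obtain ⟨hs, hc, hcomp⟩ := hα
  obtain ⟨_, h132, h231, _, _⟩ := shiftSet_perm hμ
  have htwo : ((1 : ℝ) / 2)⁻¹ = 2 := by norm_num
  have hhalf : (1 : ℝ) / 2 < R⁻¹ := by
    rw [lt_inv_comm₀ (by norm_num : (0 : ℝ) < 1 / 2) hR0, htwo]
    exact hR
  have P : ∀ {a b c : Fin m} {ν : ℤ × ℤ × ℤ}, ν ∈ shiftSet →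
      |α a b c ν| ≤ 1 ∧ (α a b c ν = 0 ∨ 1 / 2 < |α a b c ν|) := by
    intro a b c ν hν
    obtain ⟨h1, h2⟩ := hcomp a b c ν hν
    exact ⟨h1, h2.imp_right fun h => lt_of_lt_of_le hhalf h⟩
  exact signed_pair_of_sum_eq_zero (cancel_three hs hc i₁ i₂ i₃ hμ) (P hμ) (P h132) (P h231)

/-- **SINGLE-PARTNER RULE FOR SUB-DYADIC OUTFLOW.**  On `α ∈ E₂(R)`, `0 < R < 2`, an outflow constant
`u = α_{jk i,(0,0,1)} ≠ 0` (monomial `x_j x_k ↦` mode `i` of the shell above) has DISTINCT inputs `j ≠ k` (no squares,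
`sqCoeff_eq_zero_of_lt_two`) and reacts back on EXACTLY ONE of them: of the two back-reaction constants
`α_{ji k,(0,1,0)}` (`x_j y_i ↦ x_k`) and `α_{ki j,(0,1,0)}` (`x_k y_i ↦ x_j`) exactly one is non-zero, with value `−u`.
(The dyadic monomial `x² ↦ y`, excluded here, is the case where both partners coincide.)
[cite: Tao2016AveragedNS, §4 (4.1)–(4.3), §6.1; cell vocabulary (`InTableClass`)] -/
theorem outflow_single_partner_of_lt_two (hα : InTableClass R α) (hR0 : 0 < R) (hR : R < 2) {j k i : Fin m}
    (hu : α j k i ((0 : ℤ), (0 : ℤ), (1 : ℤ)) ≠ 0) :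
    j ≠ k ∧
      ((α j i k ((0 : ℤ), (1 : ℤ), (0 : ℤ)) = -α j k i ((0 : ℤ), (0 : ℤ), (1 : ℤ)) ∧
          α k i j ((0 : ℤ), (1 : ℤ), (0 : ℤ)) = 0) ∨
        (α k i j ((0 : ℤ), (1 : ℤ), (0 : ℤ)) = -α j k i ((0 : ℤ), (0 : ℤ), (1 : ℤ)) ∧
          α j i k ((0 : ℤ), (1 : ℤ), (0 : ℤ)) = 0)) := by
  have h001 : ((0 : ℤ), (0 : ℤ), (1 : ℤ)) ∈ shiftSet := by simp [mem_shiftSet_iff]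
  refine ⟨?_, (pair_rigidity_of_lt_two hα hR0 hR j k i h001).2 hu⟩
  rintro rfl
  exact hu (NoSurvivingEternalViscBddOne.SubDyadicSpread.sqCoeff_eq_zero_of_lt_two hα hR0 hR i j).1

end BlowupRigidityOne

end Summit.NavierStokesRegularity.NavierStokesRegularity.Theorems

end
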